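import Summits.MatrixMultiplication.MatrixMultiplication.Theorems.FidelityWitnessesFidelityGapThreeSixteen
import Literature.Computability.AlgebraicComplexity.BorderRankMatMulThreeSeventeen

/-!
# `FidelityWitnesses.FidelityGapThreeSixteen` (stmt-MatrixMultiplication-4963) — proved

The support item of route `MatrixMultiplication/FidelityWitnesses`

* `FidelityGapThreeSixteen : ∃ ε > 0, ∀ S (tensorRank S ≤ 16), ‖Σ S·⟨3,3,3⟩‖² ≤ (1 − ε)·27·Σ‖S‖²`

is CLOSED unconditionally: `FidelityWitnessesFidelityGapThreeSixteen.lean` reduced it to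
`17 ≤ algBorderRank (matMulTensor ℂ 3 3 3)` (`fidelityGapThreeSixteen_of_CHL`), and that statement —
Conner–Harper–Landsberg 2023, Thm. 1.1 — is now a theorem of the tree
(`ConnerHarperLandsberg2023_thm_1_1_holds`, `Literature/…/BorderRankMatMulThreeSeventeen.lean`:
elementary Borel-fixed border apolarity with the `(210)`, `(120)`, `(111)` tests evaluated by the
kernel on the Borel-fixed candidates of `⟨3,3,3⟩`).

* `fidelityGapThreeSixteen_proof : FidelityGapThreeSixteen`.
-/

namespace Summit.MatrixMultiplication.MatrixMultiplication.Theorems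

open Summit.MatrixMultiplication.MatrixMultiplication.Theses.FidelityWitnesses
open Literature.Computability.AlgebraicComplexity

/-- **`FidelityGapThreeSixteen` holds**: rank-`≤ 16` tensors have fidelity with `⟨3,3,3⟩` bounded
away from `1`, because `R̲(⟨3,3,3⟩) ≥ 17` (Conner–Harper–Landsberg 2023, Thm. 1.1, proved in the
tree). [cite: ConnerHarperLandsberg2023, Thm. 1.1] -/
theorem fidelityGapThreeSixteen_proof : FidelityGapThreeSixteen :=
  fidelityGapThreeSixteen_of_CHL ConnerHarperLandsberg2023_thm_1_1_holds

end Summit.MatrixMultiplication.MatrixMultiplication.Theorems
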